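import Summits.CriticalPhenomena.CardyFormulaZ2.Theorems.CardySelfRefinementLagHandOffNoTouchAuxSidePair
import Summits.CriticalPhenomena.CardyFormulaZ2.Theorems.CardySelfRefinementLagHandOffNoIdleAuxTraversal
import Summits.CriticalPhenomena.CardyFormulaZ2.Theorems.CardySelfRefinementLagHandOffNoIdleAuxLattice
import HarnessLib

/-!
# No one-sided touching of a fixed line by the limit interface, part 2: two one-sided shell
traversals by the bond-`ℤ²` exploration polygon force three arms in a half-annulus

Helper file for the registered stubs `stub_quadTransfer_noTouchRe` / `stub_quadTransfer_noTouchIm`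
of line `hitting-tournament` of crux `LagHandOff` (stmt-CriticalPhenomena-10268).  THE DICTIONARY
(Lawler–Schramm–Werner 2002 App. A / Aizenman–Burchard 1999 App. A, cluster form): if the
exploration polygon of a lattice configuration `ω` traverses the shell `D(x; ρ, R)` twice in a
row, far from both discrete boundary arcs, staying at height `≤ -5δ` over the line through `x`
orthogonal to the unit vector `u`, then in the half-annulus of sites
`S = {16ρ - 3δ ≤ dist ≤ R/4 + 3δ, height ≤ 0}` either `ω` has two open crossings (from
`dist ≤ 2(16ρ - 3δ)` to `dist ≥ (R/4 + 3δ)/2`) NOT joined by an open path of `S`, or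
`dualConfig ω` has two such crossings not dual-joined inside `S`
(`halfAnnulusArms_of_two_traversals`).  Proof: `traversal_data'` gives tight stretches with
middle darts; one-sidedness puts vertices, their neighbourhoods and the middle side segments in
`𝔸' = 𝔸 ∩ {height < 2δ}`; by `sidePair_ne_half` (part 1) the side pairs of the two stretches in
`𝔸'` minus the trace differ, so the LEFT or the RIGHT components differ; the chains of left
vertices (resp. right faces) are open in `ω` (resp. `dualConfig ω`), stay in their components
(`cv_mem_connectedComponentIn`), and open edges between sites of `S` are drawn in `𝔸'` off the
trace (`segment_meshPoint_disjoint_pertTrace`), so a junction inside `S` would merge the two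
components (`mem_connectedComponentIn_of_openConnIn`).

References: G. F. Lawler, O. Schramm, W. Werner, Electron. J. Probab. 7 (2002), App. A;
M. Aizenman, A. Burchard, Duke Math. J. 99 (1999), App. A; S. Smirnov, C. R. Acad. Sci. 333
(2001) §2.
-/
noncomputable section
open MeasureTheory Filter Set Topology Metric
open scoped unitInterval
open Literature.Probability.Percolation Literature.Probability.LatticeModels
open Literature.Probability.RandomPlanarGeometry
open Literature.Probability.LatticeModels.IsMedialExploration
namespace Summit.CriticalPhenomena.CardyFormulaZ2.Cruxes.LagHandOff.HittingTournament
variable {D' : DiscreteDobrushin} {ω : BondConfig (Site 2)} {a : MedialVertex}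
  {l : List MedialVertex}

/-- A segment whose ends have height `≤ c` over the line through `x` orthogonal to `u` has
height `≤ c` throughout (half-spaces are convex). -/
theorem re_conj_mul_le_of_mem_segment {u x p q z : ℂ} {c : ℝ}
    (hp : (starRingEnd ℂ u * (p - x)).re ≤ c) (hq : (starRingEnd ℂ u * (q - x)).re ≤ c)
    (hz : z ∈ segment ℝ p q) : (starRingEnd ℂ u * (z - x)).re ≤ c := by
  set f : ℂ → ℝ := fun w => (starRingEnd ℂ u * w).re with hf
  have hlin : IsLinearMap ℝ f :=
    { map_add := fun a b => by simp only [hf, mul_add, Complex.add_re]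
      map_smul := fun c a => by
        simp only [hf, Complex.real_smul, smul_eq_mul]
        rw [mul_left_comm, Complex.re_ofReal_mul] }
  have hconv : Convex ℝ {w : ℂ | f w ≤ c + f x} := convex_halfSpace_le hlin _
  have hfx : ∀ w, (starRingEnd ℂ u * (w - x)).re = f w - f x := fun w => by
    simp only [hf, mul_sub, Complex.sub_re]
  rw [hfx] at hp hq ⊢
  have hp' : p ∈ {w : ℂ | f w ≤ c + f x} := by show f p ≤ c + f x; linarith
  have hq' : q ∈ {w : ℂ | f w ≤ c + f x} := by show f q ≤ c + f x; linarith
  have : f z ≤ c + f x := hconv.segment_subset hp' hq' hz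
  linarith

-- adapted from `fourArm_of_hasTraversals` (…LagHandOffNoIdleAuxFourArm.lean): two stretches, a
-- half-annulus, and non-junction inside `S` in place of Garban's square-annulus cluster event
/-- **Two one-sided shell traversals force three arms in a half-annulus (cluster form), for the
configuration or for its dual**: the dictionary described in the module docstring (mesh `δ ≤ ρ`,
`256ρ ≤ R`, traversals during `[s₀, t₀]` and `[s₁, t₁]` with `t₀ ≤ s₁`, height `≤ -5δ` during
`[s₀, t₁]`, both discrete arcs at distance `≥ R` from `x`).
[cite: LawlerSchrammWernerEJP2002, Appendix A] [cite: AizenmanBurchardDuke1999, Appendix A] -/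
theorem halfAnnulusArms_of_two_traversals (hexp : IsMedialExploration D' ω (a :: l))
    (hδ : 0 < D'.δ) (hωE : ω ⊆ (zdGraph 2).edgeSet) {u : ℂ} (hu : ‖u‖ = 1) {x : ℂ} {ρ R : ℝ}
    (hδρ : D'.δ ≤ ρ) (hR : 256 * ρ ≤ R)
    (hfarA : ∀ v ∈ D'.zdArcA, R ≤ dist (meshPoint D'.δ v) x)
    (hfarB : ∀ v ∈ D'.zdArcB, R ≤ dist (meshPoint D'.δ v) x)
    {s₀ t₀ s₁ t₁ : I}
    (htr₀ : (⟨polyline ((a :: l).map (medialPoint D'.δ))⟩ : Curve ℂ).IsTraversal x ρ R s₀ t₀)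
    (htr₁ : (⟨polyline ((a :: l).map (medialPoint D'.δ))⟩ : Curve ℂ).IsTraversal x ρ R s₁ t₁)
    (h01 : t₀ ≤ s₁)
    (hside : ∀ r : I, s₀ ≤ r → r ≤ t₁ →
      (starRingEnd ℂ u * (polyline ((a :: l).map (medialPoint D'.δ)) r - x)).re ≤ -(5 * D'.δ)) :
    ∃ v₁ w₁ v₂ w₂ : Site 2,
      dist (meshPoint D'.δ v₁) x ≤ 2 * (16 * ρ - 3 * D'.δ) ∧
      dist (meshPoint D'.δ v₂) x ≤ 2 * (16 * ρ - 3 * D'.δ) ∧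
      (R / 4 + 3 * D'.δ) / 2 ≤ dist (meshPoint D'.δ w₁) x ∧
      (R / 4 + 3 * D'.δ) / 2 ≤ dist (meshPoint D'.δ w₂) x ∧
      ((ω ∈ openConnIn {v : Site 2 | 16 * ρ - 3 * D'.δ ≤ dist (meshPoint D'.δ v) x ∧
            dist (meshPoint D'.δ v) x ≤ R / 4 + 3 * D'.δ ∧
            (starRingEnd ℂ u * (meshPoint D'.δ v - x)).re ≤ 0} v₁ w₁ ∧
        ω ∈ openConnIn {v : Site 2 | 16 * ρ - 3 * D'.δ ≤ dist (meshPoint D'.δ v) x ∧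
            dist (meshPoint D'.δ v) x ≤ R / 4 + 3 * D'.δ ∧
            (starRingEnd ℂ u * (meshPoint D'.δ v - x)).re ≤ 0} v₂ w₂ ∧
        ω ∉ openConnIn {v : Site 2 | 16 * ρ - 3 * D'.δ ≤ dist (meshPoint D'.δ v) x ∧
            dist (meshPoint D'.δ v) x ≤ R / 4 + 3 * D'.δ ∧
            (starRingEnd ℂ u * (meshPoint D'.δ v - x)).re ≤ 0} v₁ v₂) ∨
       (dualConfig ω ∈ openConnIn {v : Site 2 | 16 * ρ - 3 * D'.δ ≤ dist (meshPoint D'.δ v) x ∧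
            dist (meshPoint D'.δ v) x ≤ R / 4 + 3 * D'.δ ∧
            (starRingEnd ℂ u * (meshPoint D'.δ v - x)).re ≤ 0} v₁ w₁ ∧
        dualConfig ω ∈ openConnIn {v : Site 2 | 16 * ρ - 3 * D'.δ ≤ dist (meshPoint D'.δ v) x ∧
            dist (meshPoint D'.δ v) x ≤ R / 4 + 3 * D'.δ ∧
            (starRingEnd ℂ u * (meshPoint D'.δ v - x)).re ≤ 0} v₂ w₂ ∧
        dualConfig ω ∉ openConnIn {v : Site 2 | 16 * ρ - 3 * D'.δ ≤ dist (meshPoint D'.δ v) x ∧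
            dist (meshPoint D'.δ v) x ≤ R / 4 + 3 * D'.δ ∧
            (starRingEnd ℂ u * (meshPoint D'.δ v - x)).re ≤ 0} v₁ v₂)) := by
  classical
  set δ := D'.δ with hδdef
  have hρ : 0 < ρ := hδ.trans_le hδρ
  set n := ((a :: l).zip l).length with hn
  set γp : I → ℂ := fun r => polyline ((a :: l).map (medialPoint δ)) r with hγp
  set S : Set (Site 2) := {v : Site 2 | 16 * ρ - 3 * δ ≤ dist (meshPoint δ v) x ∧
      dist (meshPoint δ v) x ≤ R / 4 + 3 * δ ∧ (starRingEnd ℂ u * (meshPoint δ v - x)).re ≤ 0}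
    with hSdef
  set 𝔸 : Set ℂ := ball x (R / 2) \ closedBall x (4 * ρ) with h𝔸
  set A' : Set ℂ := 𝔸 ∩ {z | (starRingEnd ℂ u * (z - x)).re < 2 * δ} with hA'
  set X : Set ℂ := A' \ hexp.pertTrace with hX
  set sT : Fin 2 → I := ![s₀, s₁] with hsT
  set tT : Fin 2 → I := ![t₀, t₁] with htT
  have htrav : ∀ q, (⟨polyline ((a :: l).map (medialPoint δ))⟩ : Curve ℂ).IsTraversal x ρ R
      (sT q) (tT q) := by
    intro q; fin_cases q
    · exact htr₀
    · exact htr₁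
  have hsT0 : ∀ q, s₀ ≤ sT q := by
    intro q; fin_cases q
    · exact le_rfl
    · exact htr₀.1.trans h01
  have htT1 : ∀ q, tT q ≤ t₁ := by
    intro q; fin_cases q
    · exact h01.trans htr₁.1
    · exact le_rfl
  have hdata := fun q : Fin 2 =>
    traversal_data' hexp hδ hδρ (le_refl (16 : ℝ)) (by linarith : 16 * 16 * ρ ≤ R) (htrav q)
  choose m i' j' hspec using hdata
  have hm1 := fun q => (hspec q).1; have hm2 := fun q => (hspec q).2.1
  have hi'm := fun q => (hspec q).2.2.1; have hmj' := fun q => (hspec q).2.2.2.1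
  have hsi' := fun q => (hspec q).2.2.2.2.1; have hj't := fun q => (hspec q).2.2.2.2.2.1
  have hends := fun q => (hspec q).2.2.2.2.2.2.1
  have hside' := fun q => (hspec q).2.2.2.2.2.2.2.1
  have hball := fun q => (hspec q).2.2.2.2.2.2.2.2.1
  have hrad := fun q => (hspec q).2.2.2.2.2.2.2.2.2.1
  have hcends := fun q => (hspec q).2.2.2.2.2.2.2.2.2.2
  clear hspec
  have htn : ∀ q, tIdx l (tT q) < n := fun q => tIdx_lt_length hexp (tT q)
  have hj'n : ∀ q, j' q < n := fun q => (hj't q).trans_lt (htn q)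
  -- heights of the stretch vertices
  have hheight : ∀ q i, tIdx l (sT q) ≤ i → i ≤ tIdx l (tT q) →
      (starRingEnd ℂ u * (meshPoint δ (hexp.cv i) - x)).re ≤ -(4 * δ) := by
    intro q i h0 h1
    obtain ⟨r, hsr, hrt, hr⟩ := exists_time_of_tIdx l (htrav q).1 h0 h1
    have hd := dist_polyline_cv_le' hexp hδ.le r
    rw [hr] at hd
    have h2 := hside r ((hsT0 q).trans hsr) (hrt.trans (htT1 q))
    have h3 := re_conj_mul_sub_le_dist hu x (meshPoint δ (hexp.cv i))
      (polyline ((a :: l).map (medialPoint δ)) r)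
    rw [dist_comm] at hd
    linarith
  have hheight' : ∀ q i, i' q ≤ i → i ≤ j' q →
      (starRingEnd ℂ u * (meshPoint δ (hexp.cv i) - x)).re ≤ -(4 * δ) := fun q i h0 h1 =>
    hheight q i ((hsi' q).trans h0) (h1.trans (hj't q))
  -- side segments of the middle darts lie in the half-annulus
  have hsideA' : ∀ q, hexp.sideSeg (m q) ⊆ A' := by
    intro q z hz
    refine ⟨hside' q hz, ?_⟩
    have h1 := hexp.sideSeg_subset_closedBall hδ ((hm2 q).trans (htn q)) hz
    simp only [IsMedialExploration.leftPt] at h1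
    rw [mem_closedBall] at h1
    have h2 := hheight' q (m q) (hi'm q) (hmj' q)
    have h3 := re_conj_mul_sub_le_dist hu x z (meshPoint δ (hexp.cv (m q)))
    show (starRingEnd ℂ u * (z - x)).re < 2 * δ
    linarith
  -- neighbourhoods of the stretch vertices lie in the half-annulus
  have hball' : ∀ q i, i' q ≤ i → i ≤ j' q → closedBall (meshPoint δ (hexp.cv i)) δ ⊆ A' := by
    intro q i h0 h1 z hz
    refine ⟨(closedBall_subset_closedBall (by linarith)).trans (hball q i h0 h1) hz, ?_⟩
    rw [mem_closedBall] at hz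
    have h2 := hheight' q i h0 h1
    have h3 := re_conj_mul_sub_le_dist hu x z (meshPoint δ (hexp.cv i))
    show (starRingEnd ℂ u * (z - x)).re < 2 * δ
    linarith
  set cL : Fin 2 → Set ℂ := fun q => connectedComponentIn X (hexp.leftPt (m q)) with hcL
  set cR : Fin 2 → Set ℂ := fun q => connectedComponentIn X (hexp.rightPt (m q)) with hcR
  have hle0 := ((hsi' 0).trans (hi'm 0)).trans ((hmj' 0).trans (hj't 0))
  have hpair : s(cL 1, cR 1) ≠ s(cL 0, cR 0) := by
    have key := sidePair_ne_half hexp hδ hu (x := x) (r₁ := 4 * ρ) (r₂ := R / 2) (h₁ := 2 * δ)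
      (by positivity) (by linarith) (by positivity) (by linarith) (ma := m 1) (mb := m 0)
      (ib := tIdx l (sT 0)) (kb := tIdx l (tT 0) - tIdx l (sT 0)) ((hm2 1).trans (htn 1))
      (by rw [Nat.add_sub_cancel' hle0]; exact htn 0)
      ⟨(hsi' 0).trans (hi'm 0), by rw [Nat.add_sub_cancel' hle0]; exact (hmj' 0).trans (hj't 0)⟩
      (by
        right
        rw [Nat.add_sub_cancel' hle0]
        exact (tIdx_mono l h01).trans_lt (hm1 1))
      (hsideA' 1) (hsideA' 0)
      (by rw [Nat.add_sub_cancel' hle0]; exact hends 0)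
    exact key
  -- the stretch vertices and faces are in the bulk
  have hcvA : ∀ q i, i' q ≤ i → i ≤ j' q → hexp.cv i ∉ D'.zdArcA := by
    intro q i h1 h2 hA
    have := hfarA _ hA
    have := (hrad q i h1 h2).2
    linarith
  have hcfcv : ∀ i, i < n → dist (meshPoint δ (hexp.cv i)) (meshPoint δ (hexp.cf i)) ≤ 2 * δ :=
    fun i hi => dist_meshPoint_le_of_isCorner hδ.le (hexp.isCorner hi)
  have hcf_rad : ∀ q i, i' q ≤ i → i ≤ j' q →
      16 * ρ - 3 * δ ≤ dist (meshPoint δ (hexp.cf i)) x ∧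
        dist (meshPoint δ (hexp.cf i)) x ≤ R / 4 + 3 * δ := by
    intro q i h1 h2
    have hi : i < n := h2.trans_lt (hj'n q)
    obtain ⟨h3, h4⟩ := hrad q i h1 h2
    have h5 := hcfcv i hi
    constructor
    · linarith [dist_triangle (meshPoint δ (hexp.cv i)) (meshPoint δ (hexp.cf i)) x]
    · linarith [dist_triangle (meshPoint δ (hexp.cf i)) (meshPoint δ (hexp.cv i)) x,
        dist_comm (meshPoint δ (hexp.cv i)) (meshPoint δ (hexp.cf i))]
  have hcf_height : ∀ q i, i' q ≤ i → i ≤ j' q →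
      (starRingEnd ℂ u * (meshPoint δ (hexp.cf i) - x)).re ≤ -(2 * δ) := by
    intro q i h1 h2
    have hi : i < n := h2.trans_lt (hj'n q)
    have h3 := hheight' q i h1 h2
    have h4 := re_conj_mul_sub_le_dist hu x (meshPoint δ (hexp.cf i)) (meshPoint δ (hexp.cv i))
    have h5 := hcfcv i hi
    rw [dist_comm] at h5
    linarith
  have hcornerB : ∀ q i, i' q ≤ i → i ≤ j' q → ∀ u', IsCorner u' (hexp.cf i) →
      u' ∉ D'.zdArcB := by
    intro q i h1 h2 u' hu' hB
    have := hfarB _ hB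
    have h3 := (hcf_rad q i h1 h2).2
    have h4 := dist_meshPoint_le_of_isCorner hδ.le hu'
    linarith [dist_triangle (meshPoint δ u') (meshPoint δ (hexp.cf i)) x]
  -- chain points lie in the side components
  have hvmem : ∀ q i, i' q ≤ i → i ≤ j' q → meshPoint δ (hexp.cv i) ∈ cL q := fun q i h1 h2 =>
    hexp.cv_mem_connectedComponentIn hδ (hj'n q) (hball' q) h1 h2 (hi'm q) (hmj' q)
  have hfmem : ∀ q i, i' q ≤ i → i ≤ j' q → (δ • faceCenter (hexp.cf i) : ℂ) ∈ cR q :=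
    fun q i h1 h2 =>
    hexp.cf_mem_connectedComponentIn hδ (hj'n q) (hball' q) h1 h2 (hi'm q) (hmj' q)
  have hin_num : 16 * ρ + 3 * δ ≤ 2 * (16 * ρ - 3 * δ) := by linarith
  have hout_num : (R / 4 + 3 * δ) / 2 ≤ R / 4 - 3 * δ := by linarith
  -- the dichotomy from the distinct side pairs of the two stretches
  have hLR : cL 0 ≠ cL 1 ∨ cR 0 ≠ cR 1 := by
    by_contra h
    push Not at h
    exact hpair (by rw [h.1, h.2])
  rcases hLR with hL | hRt
  · -- left chains, open in `ω`
    have hS_B : ∀ v ∈ S, v ∉ D'.zdArcB := by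
      intro v hv hB
      have := hfarB _ hB
      have := hv.2.1
      linarith
    have hseg : ∀ v w, v ∈ S → w ∈ S → (zdGraph 2).Adj v w → s(v, w) ∈ ω →
        segment ℝ (meshPoint δ v) (meshPoint δ w) ⊆ X := by
      intro v w hv hw hadj hvw z hz
      refine ⟨⟨segment_subset_annulus (L := δ) hv.1 hv.2.1 ?_ (by linarith) (by linarith) hz,
        ?_⟩, segment_meshPoint_disjoint_pertTrace hexp hδ hadj hvw (hS_B v hv) (hS_B w hw) z hz⟩
      · rw [dist_meshPoint_of_adj hadj, abs_of_pos hδ]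
      · show (starRingEnd ℂ u * (z - x)).re < 2 * δ
        have := re_conj_mul_le_of_mem_segment hv.2.2 hw.2.2 hz
        linarith
    have hconn : ∀ q : Fin 2, ∃ vi vo : Site 2, dist (meshPoint δ vi) x ≤ 16 * ρ + δ ∧
        R / 4 - δ ≤ dist (meshPoint δ vo) x ∧ ω ∈ openConnIn S vi vo ∧
        meshPoint δ vi ∈ cL q := by
      intro q
      set f : ℕ → Site 2 := fun p => hexp.cv (i' q + p) with hf
      set N := j' q - i' q with hN
      have step : ∀ k, i' q ≤ k → k + 1 ≤ j' q →
          hexp.cv k = hexp.cv (k + 1) ∨ s(hexp.cv k, hexp.cv (k + 1)) ∈ ω := by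
        intro k hk1 hk2
        rcases left_step_of_untainted hexp (i := k + 1) (by omega) (hk2.trans_lt (hj'n q))
          (hcvA q (k + 1) (by omega) hk2) with h | ⟨h, -⟩
        · left; simpa only [Nat.add_sub_cancel] using h
        · right; simpa only [Nat.add_sub_cancel] using h
      have hchain : ∀ p < N, f p = f (p + 1) ∨ s(f p, f (p + 1)) ∈ ω := by
        intro p hp
        have h1 : i' q + p + 1 ≤ j' q := by rw [hN] at hp; omega
        have := step (i' q + p) (by omega) h1
        simpa only [hf, add_assoc] using this
      have hS : ∀ p ≤ N, f p ∈ S := by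
        intro p hp
        have h2 : i' q + p ≤ j' q := by rw [hN] at hp; have := hi'm q; have := hmj' q; omega
        obtain ⟨h3, h4⟩ := hrad q (i' q + p) (by omega) h2
        have h5 := hheight' q (i' q + p) (by omega) h2
        exact ⟨by linarith, by linarith, by linarith⟩
      have hc0 := openConnIn_of_chain f N hchain hS
      have hf0 : f 0 = hexp.cv (i' q) := by simp [hf]
      have hfN : f N = hexp.cv (j' q) := by
        simp only [hf, hN]
        rw [Nat.add_sub_cancel' ((hi'm q).trans (hmj' q))]
      rw [hf0, hfN] at hc0
      have hij : i' q ≤ j' q := (hi'm q).trans (hmj' q)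
      rcases hcends q with ⟨h1, h2⟩ | ⟨h1, h2⟩
      · exact ⟨hexp.cv (i' q), hexp.cv (j' q), h1, h2, hc0, hvmem q _ le_rfl hij⟩
      · exact ⟨hexp.cv (j' q), hexp.cv (i' q), h2, h1, (by rw [openConnIn_comm]; exact hc0),
          hvmem q _ hij le_rfl⟩
    choose vi vo hvi hvo hco hvX using hconn
    refine ⟨vi 0, vo 0, vi 1, vo 1, by linarith [hvi 0], by linarith [hvi 1],
      by linarith [hvo 0], by linarith [hvo 1], Or.inl ⟨hco 0, hco 1, fun hjoin => hL ?_⟩⟩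
    have hX0 : meshPoint δ (vi 0) ∈ X := connectedComponentIn_subset _ _ (hvX 0)
    have e01 : meshPoint δ (vi 1) ∈ connectedComponentIn X (meshPoint δ (vi 0)) :=
      mem_connectedComponentIn_of_openConnIn hωE (P := meshPoint δ) hseg hjoin hX0
    calc cL 0 = connectedComponentIn X (meshPoint δ (vi 0)) := connectedComponentIn_eq (hvX 0)
      _ = connectedComponentIn X (meshPoint δ (vi 1)) := connectedComponentIn_eq e01
      _ = cL 1 := (connectedComponentIn_eq (hvX 1)).symm
  · -- right chains, dual-open in `dualConfig ω`
    have hωd : dualConfig ω ⊆ (zdGraph 2).edgeSet := fun e he => (mem_dualConfig_iff.1 he).1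
    have hS_A : ∀ v ∈ S, v ∉ D'.zdArcA := by
      intro v hv hA
      have := hfarA _ hA
      have := hv.2.1
      linarith
    set P : Site 2 → ℂ := fun f => δ • faceCenter f with hP
    have hPm : ∀ f, dist (P f) (meshPoint δ f) ≤ δ := fun f => dist_smul_faceCenter_meshPoint_le hδ f
    have hPh : ∀ f ∈ S, (starRingEnd ℂ u * (P f - x)).re ≤ δ := by
      intro f hf
      have h1 := re_conj_mul_sub_le_dist hu x (P f) (meshPoint δ f)
      have h2 := hf.2.2
      linarith [hPm f]
    have hseg : ∀ v w, v ∈ S → w ∈ S → (zdGraph 2).Adj v w → s(v, w) ∈ dualConfig ω →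
        segment ℝ (P v) (P w) ⊆ X := by
      intro v w hv hw hadj hvw z hz
      have hPv1 : 16 * ρ - 4 * δ ≤ dist (P v) x := by
        linarith [dist_triangle (meshPoint δ v) (P v) x, dist_comm (P v) (meshPoint δ v), hPm v,
          hv.1]
      have hPv2 : dist (P v) x ≤ R / 4 + 4 * δ := by
        linarith [dist_triangle (P v) (meshPoint δ v) x, hPm v, hv.2.1]
      have hL3 : dist (P v) (P w) ≤ 3 * δ := by
        have h1 := dist_meshPoint_of_adj (δ := δ) hadj
        rw [abs_of_pos hδ] at h1
        linarith [dist_triangle (P v) (meshPoint δ v) (P w),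
          dist_triangle (meshPoint δ v) (meshPoint δ w) (P w), hPm v, hPm w,
          dist_comm (P w) (meshPoint δ w)]
      refine ⟨⟨segment_subset_annulus hPv1 hPv2 hL3 (by linarith) (by linarith) hz, ?_⟩,
        segment_faceCenter_disjoint_pertTrace hexp hδ hadj hvw (hS_A v hv) (hS_A w hw) z hz⟩
      show (starRingEnd ℂ u * (z - x)).re < 2 * δ
      have := re_conj_mul_le_of_mem_segment (hPh v hv) (hPh w hw) hz
      linarith
    have hconn : ∀ q : Fin 2, ∃ vi vo : Site 2, dist (meshPoint δ vi) x ≤ 16 * ρ + 3 * δ ∧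
        R / 4 - 3 * δ ≤ dist (meshPoint δ vo) x ∧ dualConfig ω ∈ openConnIn S vi vo ∧
        P vi ∈ cR q := by
      intro q
      set f : ℕ → Site 2 := fun p => hexp.cf (i' q + p) with hf
      set N := j' q - i' q with hN
      have step : ∀ k, i' q ≤ k → k + 1 ≤ j' q →
          hexp.cf k = hexp.cf (k + 1) ∨ s(hexp.cf k, hexp.cf (k + 1)) ∈ dualConfig ω := by
        intro k hk1 hk2
        rcases right_step_of_untainted hexp (i := k + 1) (by omega) (hk2.trans_lt (hj'n q))
          (by simpa only [Nat.add_sub_cancel] using hcornerB q k hk1 (by omega)) with h | h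
        · left; simpa only [Nat.add_sub_cancel] using h
        · right; simpa only [Nat.add_sub_cancel] using h
      have hchain : ∀ p < N, f p = f (p + 1) ∨ s(f p, f (p + 1)) ∈ dualConfig ω := by
        intro p hp
        have h1 : i' q + p + 1 ≤ j' q := by rw [hN] at hp; omega
        have := step (i' q + p) (by omega) h1
        simpa only [hf, add_assoc] using this
      have hS : ∀ p ≤ N, f p ∈ S := by
        intro p hp
        have h2 : i' q + p ≤ j' q := by rw [hN] at hp; have := hi'm q; have := hmj' q; omega
        obtain ⟨h3, h4⟩ := hcf_rad q (i' q + p) (by omega) h2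
        have h5 := hcf_height q (i' q + p) (by omega) h2
        exact ⟨h3, h4, by linarith⟩
      have hc0 := openConnIn_of_chain f N hchain hS
      have hf0 : f 0 = hexp.cf (i' q) := by simp [hf]
      have hfN : f N = hexp.cf (j' q) := by
        simp only [hf, hN]
        rw [Nat.add_sub_cancel' ((hi'm q).trans (hmj' q))]
      rw [hf0, hfN] at hc0
      have hij : i' q ≤ j' q := (hi'm q).trans (hmj' q)
      have hi'n : i' q < n := hij.trans_lt (hj'n q)
      have hdi := hcfcv (i' q) hi'n
      have hdj := hcfcv (j' q) (hj'n q)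
      rcases hcends q with ⟨h1, h2⟩ | ⟨h1, h2⟩
      · refine ⟨hexp.cf (i' q), hexp.cf (j' q), ?_, ?_, hc0, hfmem q _ le_rfl hij⟩
        · linarith [dist_triangle (meshPoint δ (hexp.cf (i' q))) (meshPoint δ (hexp.cv (i' q))) x,
            dist_comm (meshPoint δ (hexp.cv (i' q))) (meshPoint δ (hexp.cf (i' q)))]
        · linarith [dist_triangle (meshPoint δ (hexp.cv (j' q))) (meshPoint δ (hexp.cf (j' q))) x]
      · refine ⟨hexp.cf (j' q), hexp.cf (i' q), ?_, ?_, (by rw [openConnIn_comm]; exact hc0),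
          hfmem q _ hij le_rfl⟩
        · linarith [dist_triangle (meshPoint δ (hexp.cf (j' q))) (meshPoint δ (hexp.cv (j' q))) x,
            dist_comm (meshPoint δ (hexp.cv (j' q))) (meshPoint δ (hexp.cf (j' q)))]
        · linarith [dist_triangle (meshPoint δ (hexp.cv (i' q))) (meshPoint δ (hexp.cf (i' q))) x]
    choose vi vo hvi hvo hco hvX using hconn
    refine ⟨vi 0, vo 0, vi 1, vo 1, by linarith [hvi 0], by linarith [hvi 1],
      by linarith [hvo 0], by linarith [hvo 1], Or.inr ⟨hco 0, hco 1, fun hjoin => hRt ?_⟩⟩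
    have hX0 : P (vi 0) ∈ X := connectedComponentIn_subset _ _ (hvX 0)
    have e01 : P (vi 1) ∈ connectedComponentIn X (P (vi 0)) :=
      mem_connectedComponentIn_of_openConnIn hωd (P := P) hseg hjoin hX0
    calc cR 0 = connectedComponentIn X (P (vi 0)) := connectedComponentIn_eq (hvX 0)
      _ = connectedComponentIn X (P (vi 1)) := connectedComponentIn_eq e01
      _ = cR 1 := (connectedComponentIn_eq (hvX 1)).symm

/-- **Registered sub-stub `stub_noTouch_halfAnnulusArms`** (line `hitting-tournament`, stubs
`stub_quadTransfer_noTouchRe` / `stub_quadTransfer_noTouchIm`, helper 2): the dictionary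
`halfAnnulusArms_of_two_traversals` with all arguments explicit.
[cite: LawlerSchrammWernerEJP2002, Appendix A] -/
theorem stub_noTouch_halfAnnulusArms : ∀ (D' : DiscreteDobrushin) (ω : BondConfig (Site 2)) (a : MedialVertex) (l : List MedialVertex), IsMedialExploration D' ω (a :: l) → 0 < D'.δ → ω ⊆ (zdGraph 2).edgeSet → ∀ (u : ℂ), ‖u‖ = 1 → ∀ (x : ℂ) (ρ R : ℝ), D'.δ ≤ ρ → 256 * ρ ≤ R → (∀ v ∈ D'.zdArcA, R ≤ dist (meshPoint D'.δ v) x) → (∀ v ∈ D'.zdArcB, R ≤ dist (meshPoint D'.δ v) x) → ∀ (s₀ t₀ s₁ t₁ : unitInterval), (⟨polyline ((a :: l).map (medialPoint D'.δ))⟩ : Curve ℂ).IsTraversal x ρ R s₀ t₀ → (⟨polyline ((a :: l).map (medialPoint D'.δ))⟩ : Curve ℂ).IsTraversal x ρ R s₁ t₁ → t₀ ≤ s₁ → (∀ r : unitInterval, s₀ ≤ r → r ≤ t₁ → (starRingEnd ℂ u * (polyline ((a :: l).map (medialPoint D'.δ)) r - x)).re ≤ -(5 * D'.δ)) → ∃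 v₁ w₁ v₂ w₂ : Site 2, dist (meshPoint D'.δ v₁) x ≤ 2 * (16 * ρ - 3 * D'.δ) ∧ dist (meshPoint D'.δ v₂) x ≤ 2 * (16 * ρ - 3 * D'.δ) ∧ (R / 4 + 3 * D'.δ) / 2 ≤ dist (meshPoint D'.δ w₁) x ∧ (R / 4 + 3 * D'.δ) / 2 ≤ dist (meshPoint D'.δ w₂) x ∧ ((ω ∈ openConnIn {v : Site 2 | 16 * ρ - 3 * D'.δ ≤ dist (meshPoint D'.δ v) x ∧ dist (meshPoint D'.δ v) x ≤ R / 4 + 3 * D'.δ ∧ (starRingEnd ℂ u * (meshPoint D'.δ v - x)).re ≤ 0} v₁ w₁ ∧ ω ∈ openConnIn {v : Site 2 | 16 * ρ - 3 * D'.δ ≤ dist (meshPoint D'.δ v) x ∧ dist (meshPoint D'.δ v) x ≤ R / 4 + 3 * D'.δ ∧ (starRingEnd ℂ u * (meshPoint D'.δ v - x)).re ≤ 0} v₂ w₂ ∧ ω ∉ openConnIn {v : Site 2 | 16 * ρ - 3 * D'.δ ≤ dist (meshPoint D'.δ v) x ∧ dist (meshPoint D'.δ v) x ≤ R / 4 +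 3 * D'.δ ∧ (starRingEnd ℂ u * (meshPoint D'.δ v - x)).re ≤ 0} v₁ v₂) ∨ (dualConfig ω ∈ openConnIn {v : Site 2 | 16 * ρ - 3 * D'.δ ≤ dist (meshPoint D'.δ v) x ∧ dist (meshPoint D'.δ v) x ≤ R / 4 + 3 * D'.δ ∧ (starRingEnd ℂ u * (meshPoint D'.δ v - x)).re ≤ 0} v₁ w₁ ∧ dualConfig ω ∈ openConnIn {v : Site 2 | 16 * ρ - 3 * D'.δ ≤ dist (meshPoint D'.δ v) x ∧ dist (meshPoint D'.δ v) x ≤ R / 4 + 3 * D'.δ ∧ (starRingEnd ℂ u * (meshPoint D'.δ v - x)).re ≤ 0} v₂ w₂ ∧ dualConfig ω ∉ openConnIn {v : Site 2 | 16 * ρ - 3 * D'.δ ≤ dist (meshPoint D'.δ v) x ∧ dist (meshPoint D'.δ v) x ≤ R / 4 + 3 * D'.δ ∧ (starRingEnd ℂ u * (meshPoint D'.δ v - x)).re ≤ 0} v₁ v₂)) :=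
  fun _ _ _ _ hexp hδ hωE _ hu _ _ _ hδρ hR hfarA hfarB _ _ _ _ htr₀ htr₁ h01 hside =>
    halfAnnulusArms_of_two_traversals hexp hδ hωE hu hδρ hR hfarA hfarB htr₀ htr₁ h01 hside

end Summit.CriticalPhenomena.CardyFormulaZ2.Cruxes.LagHandOff.HittingTournament

end
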